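import Summits.CriticalPhenomena.Ising3DConformalLimit.Theses.IsingEuclidUpgrade
import Literature.MathematicalPhysics.QuantumFieldTheory.MirrorRPKernel

/-!
# Sketch — crux ideas for `IsingEuclidUpgradeR2RotInvPowerLaw` (stmt-CriticalPhenomena-0634), ideator 2, round 1

Statements only (no proofs).  Two levers, both acting with NINE-MIRROR REFLECTION-POSITIVITY RIGIDITY
directly on the zoom orbit `r ↦ (x ↦ G(⌊r x⌋))` of the lattice two-point function
`G = criticalTwoPoint 3`, WITHOUT any scaling limit:

* idea A `haar-averaged-zoom-isotropy` — Haar (logarithmic) averaging over the dilation orbit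
  manufactures EXACT homogeneity, so the landed homogeneous rigidity theorem (item 1979
  `HRP2Rigidity`, `Cruxes.HRP2Rigidity.XRayMellin.nineMirrorRigidityBelowFour`) already yields the
  isotropic pure power law IN LOG-CESÀRO MEAN from two-sided power bounds (item 4662) alone:
  `LogCesaroTwoPointLaw`, `LogCesaroLawOfAxisLaw`.
* idea B `stieltjes-sections-without-homogeneity` — a homogeneity-FREE nine-mirror rigidity theorem
  (`StieltjesSectionRigidity`, conjecture R*) makes every tangent kernel of a merely DOUBLING
  two-point function radial, hence cofinite ratio isotropy (the registered stub
  `stub_ratioIsotropy` = split child D2) from item 6150 alone: `RatioIsotropyOfDoubling`.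
-/

namespace Summit.CriticalPhenomena.Ising3DConformalLimit.Cruxes.IsingEuclidUpgradeR2RotInvPowerLaw.SketchZoomRigidity

open Literature.Probability.LatticeModels

/-- The registered stub S3 / split child D2 `IsingEuclidUpgradeR2RatioIsotropy` (verbatim):
lattice RATIO isotropy, exponent-free. -/
def RatioIsotropy : Prop :=
  Filter.Tendsto (fun x : Literature.Probability.LatticeModels.Site 3 =>
    Literature.Probability.LatticeModels.criticalTwoPoint 3 x /
      Literature.Probability.LatticeModels.criticalTwoPoint 3
        (Pi.single 0 ((⌊Real.sqrt (∑ i, ((x i : ℝ)) ^ 2)⌋₊ : ℕ) : ℤ))) Filter.cofinite (nhds 1)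

/-- Item 6150 `MirrorHoelderCompactness.TwoPointDoubling` (verbatim): all-scale axis doubling. -/
def TwoPointDoubling : Prop :=
  ∃ κ : ℝ, 0 < κ ∧ ∀ n : ℕ, 1 ≤ n →
    κ * Literature.Probability.LatticeModels.criticalTwoPoint 3 (Pi.single 0 (n : ℤ)) ≤
      Literature.Probability.LatticeModels.criticalTwoPoint 3 (Pi.single 0 (2 * (n : ℤ)))

/-- **Conjecture R\* (first lemma of idea B): nine-mirror reflection-positivity rigidity WITHOUT
homogeneity.**  A continuous positive tempered kernel on `ℝ³ ∖ 0` that is invariant and reflection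
positive for each of the nine lattice mirrors `n ∈ {eᵢ, eᵢ ± eⱼ}` is invariant under every linear
isometry.  It is item 1979 `HRP2Rigidity` with the clause `K (c • x) = c^{-2Δ} K x` DELETED (and a
two-sided polynomial growth bound added so that the Fourier/OS machinery applies).  Mechanism
proposed: per mirror the landed homogeneity-free half-plane continuation
(`stub_halfPlaneContinuation`, Bernstein–Widder) makes every partial Fourier section
`k_n² ↦ K̂(k_n n + q)` a Stieltjes function for EVERY transverse momentum `q`; Siciak's separate
analyticity theorem gives a joint holomorphic extension, and positivity of the section measures
UNIFORMLY IN LARGE `|q|` excludes every anisotropic (cubic-harmonic) deformation. -/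
def StieltjesSectionRigidity : Prop :=
  ∀ (K : EuclideanSpace ℝ (Fin 3) → ℝ), ContinuousOn K {0}ᶜ → (∀ x, x ≠ 0 → 0 < K x) →
    (∃ C A : ℝ, ∀ x, x ≠ 0 → K x ≤ C * (‖x‖ ^ A + ‖x‖ ^ (-A))) →
    (∀ n : EuclideanSpace ℝ (Fin 3),
      (∃ i j : Fin 3, i ≠ j ∧ (n = EuclideanSpace.single i 1 ∨
        n = EuclideanSpace.single i 1 + EuclideanSpace.single j 1 ∨
        n = EuclideanSpace.single i 1 - EuclideanSpace.single j 1)) →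
      (∀ x, K (((ℝ ∙ n)ᗮ).reflection x) = K x) ∧
        Literature.MathematicalPhysics.QuantumFieldTheory.IsMirrorRPKernel n K) →
    ∀ (R : EuclideanSpace ℝ (Fin 3) ≃ₗᵢ[ℝ] EuclideanSpace ℝ (Fin 3)) (x : EuclideanSpace ℝ (Fin 3)),
      K (R x) = K x

/-- **Transfer of idea B** (`C⁺ → stub`): all-scale doubling (item 6150) and the homogeneity-free
rigidity R\* give lattice ratio isotropy (stub S3 / child D2), with NO scaling limit and NO exponent:
doubling ⟹ (orbitPrecompact_iff_doubling, mirror-Hölder modulus) every sequence of scales has a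
locally uniform TANGENT KERNEL `K = lim G(⌊r_k x⌋)/G(⌊r_k⌋ e₀)`, continuous, positive, polynomially
bounded, nine-mirror invariant and RP (inherited from `CriticalCorrNineMirrorRP`, item 1985, landed);
R\* makes every tangent kernel radial; a direction `x̂_k → x̂` with `|G(x_k)/g(⌊|x_k|⌋) − 1| ≥ ε`
contradicts `K(x̂) = K(e₀)`. -/
def RatioIsotropyOfDoubling : Prop :=
  TwoPointDoubling → StieltjesSectionRigidity → RatioIsotropy

/-- **Idea A, conclusion: the isotropic pure power law IN LOG-CESÀRO MEAN from two-sided power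
bounds alone.**  If `c‖x‖^{-(1+η)} ≤ G(x) ≤ C‖x‖^{-(1+η)}` (item 4662 `EtaBoundsExist` supplies such
an `η`), then for every unit direction `u` the Haar-averaged radial profiles along `u` and along the
axis agree asymptotically:
`(∫₁^R r^η G(⌊r u⌋) dr) / (∫₁^R r^η G(⌊r⌋ e₀) dr) → 1`.
Mechanism: the log-averaged zooms `K̄_R(x) := (log R)⁻¹ ∫₁^R r^{1+η} G(⌊r x⌋) dr/r` are precompact in
`C_loc(ℝ³ ∖ 0)` (bounds + mirror-Hölder modulus), every cluster point is EXACTLY homogeneous of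
degree `−(1+η)` (Haar averaging: `K̄_R(λx) − λ^{-(1+η)} K̄_R(x) = O(log λ / log R)`), continuous,
positive and nine-mirror RP, hence RADIAL by the landed `nineMirrorRigidityBelowFour`
(`0 < 1+η < 4`); the ratio statement follows cluster point by cluster point. -/
def LogCesaroTwoPointLaw : Prop :=
  ∀ η : ℝ, Literature.Probability.LatticeModels.HasIsingEtaBounds 3 η →
    ∀ u : Fin 3 → ℝ, Real.sqrt (∑ i, u i ^ 2) = 1 →
      Filter.Tendsto (fun R : ℝ =>
        (∫ r in (1:ℝ)..R, r ^ η *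
            Literature.Probability.LatticeModels.criticalTwoPoint 3 (fun i => ⌊r * u i⌋)) /
          (∫ r in (1:ℝ)..R, r ^ η *
            Literature.Probability.LatticeModels.criticalTwoPoint 3 (Pi.single 0 ⌊r⌋)))
        Filter.atTop (nhds 1)

/-- **Idea A, corollary for the AXIS × ANGLE split** (`r2 ⟺ D1 ∧ D2`, strategist glue
`IsingEuclidUpgradeR2RotInvPowerLaw_of_subs`): given ONLY the axial pure power law D1 (which implies
the two-sided bounds), the full crux holds in log-Cesàro mean in EVERY direction with the SAME
constant: `(log R)⁻¹ ∫₁^R r^{2Δ−1} G(⌊r u⌋) dr → c`.  So after D1 the only scenario left against D2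
is anisotropy that OSCILLATES in `log r` with zero mean — exactly what idea B's R\* (or the
full-limit route of `same-mesh-isotropy-transfer`) excludes. -/
def LogCesaroLawOfAxisLaw : Prop :=
  ∀ Δ c : ℝ, 0 < c →
    Filter.Tendsto (fun n : ℕ =>
      Literature.Probability.LatticeModels.criticalTwoPoint 3 (Pi.single 0 (n : ℤ)) * (n : ℝ) ^ (2 * Δ))
      Filter.atTop (nhds c) →
    ∀ u : Fin 3 → ℝ, Real.sqrt (∑ i, u i ^ 2) = 1 →
      Filter.Tendsto (fun R : ℝ =>
        (∫ r in (1:ℝ)..R, r ^ (2 * Δ - 1) *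
            Literature.Probability.LatticeModels.criticalTwoPoint 3 (fun i => ⌊r * u i⌋)) / Real.log R)
        Filter.atTop (nhds c)

/-- Bookkeeping check: the crux decl is the conjunction target of both ideas' transfers (D1 ∧ D2 ⟹ r2
is the strategist's proved split glue; here only the name is pinned). -/
example : Summit.CriticalPhenomena.Ising3DConformalLimit.Theses.IsingEuclidUpgrade.IsingEuclidUpgradeR2RotInvPowerLaw =
    (∃ Δ c : ℝ, 0 < c ∧ Filter.Tendsto (fun x : Literature.Probability.LatticeModels.Site 3 =>
      Literature.Probability.LatticeModels.criticalTwoPoint 3 x * Real.sqrt (∑ i, ((x i : ℝ)) ^ 2) ^ (2 * Δ))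
      Filter.cofinite (nhds c)) := rfl

end Summit.CriticalPhenomena.Ising3DConformalLimit.Cruxes.IsingEuclidUpgradeR2RotInvPowerLaw.SketchZoomRigidity
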